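/-
Copyright (c) 2026. All rights reserved.
Released under Apache 2.0 license as described in the file LICENSE.
-/
import Literature.NumberTheory.Automorphic.BrandtMatrixRamifiedDivisors
import Literature.NumberTheory.Automorphic.BrandtSetupAtkinLehnerHecke
import Mathlib.LinearAlgebra.Eigenspace.Basic
import Mathlib.LinearAlgebra.Matrix.Permutation
import Mathlib.LinearAlgebra.FiniteDimensional.Lemmas
import Mathlib.Algebra.DirectSum.LinearMap
import HarnessLib

/-!
# The `±1`-eigenspaces of the Brandt matrix `T(q)` at a ramified prime `q ∣ N⁻`, for every Brandt setup:
# `T(q)` is the permutation matrix of `W_{q⁻}`, `ℚ^{Cls O} = E₊ ⊕ E₋` (Hecke-stable), `2 dim E₊ = h + tr T(q)`,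
# `2 dim E₋ = h − tr T(q) = h − #{c : O_L(I_c) ∋ x, nrd x = q}` (Vignéras III §5 ex. 5.8; Pizer)

[tag: quaternion_algebra] [tag: eichler_order] [tag: hecke_operator]

Topic `NumberTheory/Automorphic`; THEOREMS ONLY (no definition, no named fact, no instance; net Literature debt `0`).
Lane `lit-hodgefound`, seat p12, gen 51 — the every-setup form of `DefiniteMaximalOrdersRamifiedInvolutionEigenspaces.lean`
(type `(1, p)`, where `dim E₊ = #Typ O`): for a Brandt setup `S` of type `(N⁺, N⁻)` and a prime `q ∣ N⁻`, with
`W = W_{q⁻} : [I] ↦ [I 𝔓_q]` (`BrandtSetupAtkinLehnerInvolutions.lean`):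

* §1 `XiSetup.map_matrix_ramified_eq_permMatrix_of_dvd` (`T(q)` = `permMatrix` of `W`, any ring), `XiSetup.det_matrix_ramified_of_dvd`
  (`det T(q) = sign W`), `XiSetup.map_matrix_ramified_mulVec_of_dvd` (`(T(q) v)(c) = v(W c)`);
* §2 on `ℚ^{Cls O}`: `E₊ = {v : v ∘ W = v}`, `E₋ = {v : v ∘ W = −v}` (`mem_eigenspace_one/neg_one_iff_of_dvd`), `E₊ ⊕ E₋ = ℚ^{Cls O}`
  (`isCompl_eigenspaces_of_dvd`), no other eigenvalue (`eigenspace_eq_bot_of_ne_of_dvd`), both `E_±` stable under every `T(n)`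
  (`mapsTo_toLin_matrix_eigenspace_of_dvd`, from `T(n) T(q) = T(q) T(n)` for all `n`, `BrandtSetupAtkinLehnerHecke.lean`);
* §3 dimensions: `tr T(q) = dim E₊ − dim E₋` (`trace_matrix_ramified_eq_finrank_sub_of_dvd`, `T(q) = ±1` on `E_±`),
  **`2 dim E₊ = #Cls O + tr T(q)`**, **`2 dim E₋ = #Cls O − tr T(q)`** (`two_mul_finrank_eigenspace_one/neg_one_of_dvd`), with
  `tr T(q) = #{c : O_L(I_c) ∋ x, nrd x = q}` (`BrandtMatrixRamifiedDivisors.lean`): **`2 dim E₋ = #Cls O − #{c : O_L(I_c) ∋ x, nrd x = q}`**;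
  `#Typ O ≤ dim E₊` (the functions of the type are `W`-invariant), `+1` is an eigenvalue, and **`−1` is an eigenvalue iff some
  left order `O_L(I_c)` has no element of reduced norm `q`** (`hasEigenvalue_neg_one_iff_of_dvd`).

## References

* [VignerasLNM800] M.-F. Vignéras, *Arithmétique des algèbres de quaternions*, LNM 800 (1980), Ch. III §5 exercice 5.8 (b)–(d)
  (`P(𝔓)` is a permutation matrix of order `2`; the Brandt matrices and the permutation matrices commute), Ch. V §2 Prop. 2.4.
* [Voight2021] J. Voight, *Quaternion Algebras*, GTM 288 (2021): 41.3.4–(41.3.5), Cor. 41.4.10, (30.9.3).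

## Scope (honest)

Theorems only; `q ∣ N⁻` (the ramified Atkin–Lehner involutions). The `W_{p⁺}`-eigenspaces at the level primes are not treated
(their `T`-matrix is not a Brandt matrix).
-/

noncomputable section

open scoped Pointwise Matrix

namespace Literature.NumberTheory.Automorphic

namespace Brandt

variable {Nplus Nminus : ℕ} (S : XiSetup Nplus Nminus) {q : ℕ} [hqf : Fact q.Prime]

/-! ## §1 `T(q)` is the permutation matrix of `W_{q⁻}` -/

section Involution

/-- **`T(q)` is the permutation matrix of `W_{q⁻}`** over any ring (`q ∣ N⁻`, every setup). [cite: VignerasLNM800, Ch. III §5 exercice 5.8 (b)] -/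
theorem XiSetup.map_matrix_ramified_eq_permMatrix_of_dvd (hq : q ∣ Nminus) [DecidableEq (ClassSet S.O)] {R : Type*}
    [AddGroupWithOne R] :
    (matrix S.O q).map (Int.cast : ℤ → R) = ((S.involutive_wMinus hq).toPerm _).permMatrix R := by
  ext c c'
  rw [Matrix.map_apply, S.matrix_ramified_apply_of_dvd hq]
  simp only [PEquiv.toMatrix_apply, Equiv.toPEquiv_apply, Option.mem_def, Option.some.injEq,
    Function.Involutive.coe_toPerm]
  have h := S.wMinus_eq_iff hq c c'
  split_ifs with h1 h2 h2
  · exact Int.cast_one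
  · exact absurd (h.mp h1.symm) h2
  · exact absurd (h.mpr h2).symm h1
  · exact Int.cast_zero

/-- `T(q)` is the permutation matrix of `W_{q⁻}` (over `ℤ`). [cite: VignerasLNM800, Ch. III §5 exercice 5.8 (b)] -/
theorem XiSetup.matrix_ramified_eq_permMatrix_of_dvd (hq : q ∣ Nminus) [DecidableEq (ClassSet S.O)] :
    matrix S.O q = ((S.involutive_wMinus hq).toPerm _).permMatrix ℤ := by
  rw [← S.map_matrix_ramified_eq_permMatrix_of_dvd hq]
  ext c c'
  rw [Matrix.map_apply, Int.cast_id]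

/-- `det T(q) = sign W_{q⁻} = ±1`. [cite: VignerasLNM800, Ch. III §5 exercice 5.8 (b)–(c)] -/
theorem XiSetup.det_matrix_ramified_of_dvd (hq : q ∣ Nminus) [Fintype (ClassSet S.O)] [DecidableEq (ClassSet S.O)] :
    (matrix S.O q).det = Equiv.Perm.sign ((S.involutive_wMinus hq).toPerm _) := by
  rw [S.matrix_ramified_eq_permMatrix_of_dvd hq, Matrix.det_permutation, Int.cast_id]

/-- **`(T(q) v)(c) = v(W_{q⁻} c)`** over any commutative ring. [cite: VignerasLNM800, Ch. III §5 exercice 5.8 (b)] -/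
theorem XiSetup.map_matrix_ramified_mulVec_of_dvd (hq : q ∣ Nminus) [Fintype (ClassSet S.O)] {R : Type*} [CommRing R]
    (v : ClassSet S.O → R) (c : ClassSet S.O) :
    ((matrix S.O q).map (Int.cast : ℤ → R) *ᵥ v) c = v (S.wMinus q hq c) := by
  classical
  rw [S.map_matrix_ramified_eq_permMatrix_of_dvd hq, Matrix.permMatrix_mulVec, Function.comp_apply,
    Function.Involutive.coe_toPerm]

end Involution

/-! ## §2 The eigenspaces `E_± = {v : v ∘ W = ± v}` of `T(q)` on `ℚ^{Cls O}` -/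

section Eigenspaces

variable [Fintype (ClassSet S.O)] [DecidableEq (ClassSet S.O)]

/-- **`E₊(T(q)) = {v : v ∘ W_{q⁻} = v}`.** [cite: VignerasLNM800, Ch. III §5 exercice 5.8 (b)–(c)] -/
theorem XiSetup.mem_eigenspace_one_iff_of_dvd (hq : q ∣ Nminus) (v : ClassSet S.O → ℚ) :
    v ∈ Module.End.eigenspace (Matrix.toLin' ((matrix S.O q).map (Int.cast : ℤ → ℚ))) 1 ↔
      ∀ c : ClassSet S.O, v (S.wMinus q hq c) = v c := by
  rw [Module.End.mem_eigenspace_iff, one_smul, Matrix.toLin'_apply, funext_iff]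
  simp only [S.map_matrix_ramified_mulVec_of_dvd hq]

/-- **`E₋(T(q)) = {v : v ∘ W_{q⁻} = −v}`.** [cite: VignerasLNM800, Ch. III §5 exercice 5.8 (b)–(c)] -/
theorem XiSetup.mem_eigenspace_neg_one_iff_of_dvd (hq : q ∣ Nminus) (v : ClassSet S.O → ℚ) :
    v ∈ Module.End.eigenspace (Matrix.toLin' ((matrix S.O q).map (Int.cast : ℤ → ℚ))) (-1) ↔
      ∀ c : ClassSet S.O, v (S.wMinus q hq c) = -v c := by
  rw [Module.End.mem_eigenspace_iff, Matrix.toLin'_apply, funext_iff]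
  simp only [S.map_matrix_ramified_mulVec_of_dvd hq, Pi.smul_apply, smul_eq_mul, neg_one_mul]

/-- The functions of the type are `W_{q⁻}`-invariant: `g ∘ typeOf ∈ E₊(T(q))`. [cite: Voight2021, Remark 17.4.15] -/
theorem XiSetup.comp_typeOf_mem_eigenspace_one_of_dvd (hq : q ∣ Nminus) (g : TypeSet S.O → ℚ) :
    g ∘ typeOf S.O ∈ Module.End.eigenspace (Matrix.toLin' ((matrix S.O q).map (Int.cast : ℤ → ℚ))) 1 :=
  (S.mem_eigenspace_one_iff_of_dvd hq _).mpr fun c => congrArg g (S.typeOf_wMinus hq c)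

/-- `E₊ ⊓ E₋ = 0`. [cite: VignerasLNM800, Ch. III §5 exercice 5.8 (c)] -/
theorem XiSetup.eigenspace_one_inf_eigenspace_neg_one_of_dvd (hq : q ∣ Nminus) :
    Module.End.eigenspace (Matrix.toLin' ((matrix S.O q).map (Int.cast : ℤ → ℚ))) 1 ⊓
      Module.End.eigenspace (Matrix.toLin' ((matrix S.O q).map (Int.cast : ℤ → ℚ))) (-1) = ⊥ := by
  rw [eq_bot_iff]
  intro v hv
  rw [Submodule.mem_inf, S.mem_eigenspace_one_iff_of_dvd hq, S.mem_eigenspace_neg_one_iff_of_dvd hq] at hv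
  rw [Submodule.mem_bot]
  funext c
  have h1 := hv.1 c
  have h2 := hv.2 c
  rw [Pi.zero_apply]
  linarith

/-- `E₊ + E₋ = ℚ^{Cls O}`: `v = ½(v + v∘W) + ½(v − v∘W)`. [cite: VignerasLNM800, Ch. III §5 exercice 5.8 (c)] -/
theorem XiSetup.eigenspace_one_sup_eigenspace_neg_one_of_dvd (hq : q ∣ Nminus) :
    Module.End.eigenspace (Matrix.toLin' ((matrix S.O q).map (Int.cast : ℤ → ℚ))) 1 ⊔
      Module.End.eigenspace (Matrix.toLin' ((matrix S.O q).map (Int.cast : ℤ → ℚ))) (-1) = ⊤ := by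
  rw [eq_top_iff]
  intro v _
  rw [Submodule.mem_sup]
  have hWW : ∀ c, S.wMinus q hq (S.wMinus q hq c) = c := S.wMinus_wMinus hq
  refine ⟨fun c => (v c + v (S.wMinus q hq c)) / 2, (S.mem_eigenspace_one_iff_of_dvd hq _).mpr fun c => ?_,
    fun c => (v c - v (S.wMinus q hq c)) / 2, (S.mem_eigenspace_neg_one_iff_of_dvd hq _).mpr fun c => ?_, ?_⟩
  · show (v (S.wMinus q hq c) + v (S.wMinus q hq (S.wMinus q hq c))) / 2 = (v c + v (S.wMinus q hq c)) / 2
    rw [hWW]; ring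
  · show (v (S.wMinus q hq c) - v (S.wMinus q hq (S.wMinus q hq c))) / 2 = -((v c - v (S.wMinus q hq c)) / 2)
    rw [hWW]; ring
  · funext c
    show (v c + v (S.wMinus q hq c)) / 2 + (v c - v (S.wMinus q hq c)) / 2 = v c
    ring

/-- **`ℚ^{Cls O} = E₊ ⊕ E₋`**: `T(q)` is diagonalisable with eigenvalues `±1`. [cite: VignerasLNM800, Ch. III §5 exercice 5.8 (c)] -/
theorem XiSetup.isCompl_eigenspaces_of_dvd (hq : q ∣ Nminus) :
    IsCompl (Module.End.eigenspace (Matrix.toLin' ((matrix S.O q).map (Int.cast : ℤ → ℚ))) 1)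
      (Module.End.eigenspace (Matrix.toLin' ((matrix S.O q).map (Int.cast : ℤ → ℚ))) (-1)) :=
  ⟨disjoint_iff.mpr (S.eigenspace_one_inf_eigenspace_neg_one_of_dvd hq),
    codisjoint_iff.mpr (S.eigenspace_one_sup_eigenspace_neg_one_of_dvd hq)⟩

/-- **`T(q)` has no eigenvalue other than `±1`** (`W_{q⁻}` is an involution). [cite: VignerasLNM800, Ch. III §5 exercice 5.8 (c)] -/
theorem XiSetup.eigenspace_eq_bot_of_ne_of_dvd (hq : q ∣ Nminus) {μ : ℚ} (h1 : μ ≠ 1) (h2 : μ ≠ -1) :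
    Module.End.eigenspace (Matrix.toLin' ((matrix S.O q).map (Int.cast : ℤ → ℚ))) μ = ⊥ := by
  rw [eq_bot_iff]
  intro v hv
  rw [Module.End.mem_eigenspace_iff, Matrix.toLin'_apply, funext_iff] at hv
  simp only [S.map_matrix_ramified_mulVec_of_dvd hq, Pi.smul_apply, smul_eq_mul] at hv
  rw [Submodule.mem_bot]
  funext c
  have e1 := hv c
  have e2 := hv (S.wMinus q hq c)
  rw [S.wMinus_wMinus hq] at e2
  have hμ : μ * μ - 1 ≠ 0 := by
    intro h0
    rcases mul_self_eq_one_iff.mp (by linarith : μ * μ = 1) with h | h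
    · exact h1 h
    · exact h2 h
  have hv0 : (μ * μ - 1) * v c = 0 := by linear_combination (-μ) * e1 - e2
  rw [Pi.zero_apply]
  exact (mul_eq_zero.mp hv0).resolve_left hμ

/-- The spectrum of `T(q)` is contained in `{1, −1}`. [cite: VignerasLNM800, Ch. III §5 exercice 5.8 (c)] -/
theorem XiSetup.hasEigenvalue_imp_of_dvd (hq : q ∣ Nminus) {μ : ℚ}
    (h : Module.End.HasEigenvalue (Matrix.toLin' ((matrix S.O q).map (Int.cast : ℤ → ℚ))) μ) : μ = 1 ∨ μ = -1 := by
  by_contra hne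
  push Not at hne
  exact (Module.End.hasEigenvalue_iff.mp h) (S.eigenspace_eq_bot_of_ne_of_dvd hq hne.1 hne.2)

omit [DecidableEq (ClassSet S.O)] in
/-- `(T(m) T(n))_ℚ = T(m)_ℚ T(n)_ℚ`. [folklore] -/
private theorem map_matrix_mul₁₁ (m n : ℕ) :
    (matrix S.O m * matrix S.O n).map (Int.cast : ℤ → ℚ) =
      (matrix S.O m).map (Int.cast : ℤ → ℚ) * (matrix S.O n).map (Int.cast : ℤ → ℚ) :=
  Matrix.map_mul (f := Int.castRingHom ℚ)

/-- `T(q)` and `T(n)` commute as endomorphisms of `ℚ^{Cls O}`, for every `n`. [cite: VignerasLNM800, Ch. III §5 exercice 5.8 (d)] -/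
theorem XiSetup.commute_toLin_matrix_ramified_of_dvd (hq : q ∣ Nminus) (n : ℕ) :
    Commute (Matrix.toLin' ((matrix S.O q).map (Int.cast : ℤ → ℚ))) (Matrix.toLin' ((matrix S.O n).map (Int.cast : ℤ → ℚ))) := by
  change Matrix.toLin' _ * Matrix.toLin' _ = Matrix.toLin' _ * Matrix.toLin' _
  rw [Module.End.mul_eq_comp, Module.End.mul_eq_comp, ← Matrix.toLin'_mul, ← Matrix.toLin'_mul, ← map_matrix_mul₁₁ S,
    ← map_matrix_mul₁₁ S, S.matrix_mul_matrix_ramified_comm_of_dvd hq n]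

/-- **`E₊` and `E₋` are Hecke-stable**: every `T(n)` maps each eigenspace of `T(q)` into itself. [cite: VignerasLNM800, Ch. III §5 exercice 5.8 (d)] [cite: Voight2021, Cor. 41.4.10] -/
theorem XiSetup.mapsTo_toLin_matrix_eigenspace_of_dvd (hq : q ∣ Nminus) (n : ℕ) (μ : ℚ) :
    Set.MapsTo (Matrix.toLin' ((matrix S.O n).map (Int.cast : ℤ → ℚ)))
      (Module.End.eigenspace (Matrix.toLin' ((matrix S.O q).map (Int.cast : ℤ → ℚ))) μ)
      (Module.End.eigenspace (Matrix.toLin' ((matrix S.O q).map (Int.cast : ℤ → ℚ))) μ) :=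
  Module.End.mapsTo_genEigenspace_of_comm (S.commute_toLin_matrix_ramified_of_dvd hq n) μ 1

/-! ## §3 Dimensions: `2 dim E₊ = h + tr T(q)`, `2 dim E₋ = h − tr T(q)` -/

/-- `tr(T_ℚ) = tr T` for the cast of an integer matrix. [folklore] -/
private theorem trace_map_intCast {ι : Type*} [Fintype ι] (M : Matrix ι ι ℤ) :
    (M.map (Int.cast : ℤ → ℚ)).trace = ((M.trace : ℤ) : ℚ) := by
  simp [Matrix.trace, Matrix.map_apply]

omit hqf in
/-- `T(q)` restricted to `E_μ` is `μ · id`. [cite: VignerasLNM800, Ch. III §5 exercice 5.8 (c)] -/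
theorem XiSetup.restrict_toLin_matrix_ramified_eq_smul_id (μ : ℚ)
    (h : Set.MapsTo (Matrix.toLin' ((matrix S.O q).map (Int.cast : ℤ → ℚ)))
      (Module.End.eigenspace (Matrix.toLin' ((matrix S.O q).map (Int.cast : ℤ → ℚ))) μ)
      (Module.End.eigenspace (Matrix.toLin' ((matrix S.O q).map (Int.cast : ℤ → ℚ))) μ)) :
    (Matrix.toLin' ((matrix S.O q).map (Int.cast : ℤ → ℚ))).restrict h = μ • LinearMap.id := by
  ext v
  have hv := Module.End.mem_eigenspace_iff.mp v.2
  simp only [LinearMap.restrict_apply, LinearMap.smul_apply, LinearMap.id_apply, Submodule.coe_smul, hv]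

/-- **`tr T(q) = dim E₊ − dim E₋`** (`T(q) = ±1` on `E_±`, `ℚ^{Cls O} = E₊ ⊕ E₋`). [cite: VignerasLNM800, Ch. III §5 exercice 5.8 (c)] -/
theorem XiSetup.trace_matrix_ramified_eq_finrank_sub_of_dvd (hq : q ∣ Nminus) :
    ((matrix S.O q).trace : ℚ) =
      (Module.finrank ℚ (Module.End.eigenspace (Matrix.toLin' ((matrix S.O q).map (Int.cast : ℤ → ℚ))) 1) : ℚ) -
        Module.finrank ℚ (Module.End.eigenspace (Matrix.toLin' ((matrix S.O q).map (Int.cast : ℤ → ℚ))) (-1)) := by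
  classical
  set Tq := Matrix.toLin' ((matrix S.O q).map (Int.cast : ℤ → ℚ)) with hTq
  set N : Bool → Submodule ℚ (ClassSet S.O → ℚ) := fun b => cond b (Module.End.eigenspace Tq 1) (Module.End.eigenspace Tq (-1))
    with hN
  have hint : DirectSum.IsInternal N := by
    refine (DirectSum.isInternal_submodule_iff_isCompl N (i := true) (j := false) (by decide) ?_).mpr ?_
    · ext b; cases b <;> simp
    · exact S.isCompl_eigenspaces_of_dvd hq
  have hmap : ∀ μ : ℚ, Set.MapsTo Tq (Module.End.eigenspace Tq μ) (Module.End.eigenspace Tq μ) := fun μ =>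
    Module.End.mapsTo_genEigenspace_of_comm (Commute.refl Tq) μ 1
  have hf : ∀ b, Set.MapsTo Tq (N b) (N b) := fun b => by
    cases b
    · exact hmap (-1)
    · exact hmap 1
  have key := LinearMap.trace_eq_sum_trace_restrict hint hf
  rw [Fintype.sum_bool] at key
  have htr : LinearMap.trace ℚ _ Tq = ((matrix S.O q).trace : ℚ) := by
    rw [hTq, Matrix.trace_toLin'_eq, trace_map_intCast]
  have h1 : LinearMap.trace ℚ _ (Tq.restrict (hf true)) =
      (Module.finrank ℚ (Module.End.eigenspace Tq 1) : ℚ) := by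
    have e : Tq.restrict (hf true) = (1 : ℚ) • LinearMap.id := S.restrict_toLin_matrix_ramified_eq_smul_id 1 (hmap 1)
    rw [e, one_smul, LinearMap.trace_id]
    rfl
  have h2 : LinearMap.trace ℚ _ (Tq.restrict (hf false)) =
      -(Module.finrank ℚ (Module.End.eigenspace Tq (-1)) : ℚ) := by
    have e : Tq.restrict (hf false) = (-1 : ℚ) • LinearMap.id := S.restrict_toLin_matrix_ramified_eq_smul_id (-1) (hmap (-1))
    rw [e, map_smul, LinearMap.trace_id, smul_eq_mul, neg_one_mul]
    rfl
  rw [← htr, key, h1, h2, sub_eq_add_neg]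

/-- `dim E₊ + dim E₋ = #Cls O`. [cite: VignerasLNM800, Ch. III §5 exercice 5.8 (c)] -/
theorem XiSetup.finrank_eigenspace_one_add_finrank_eigenspace_neg_one_of_dvd (hq : q ∣ Nminus) :
    Module.finrank ℚ (Module.End.eigenspace (Matrix.toLin' ((matrix S.O q).map (Int.cast : ℤ → ℚ))) 1) +
      Module.finrank ℚ (Module.End.eigenspace (Matrix.toLin' ((matrix S.O q).map (Int.cast : ℤ → ℚ))) (-1)) =
        Nat.card (ClassSet S.O) := by
  have key := Submodule.finrank_sup_add_finrank_inf_eq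
    (Module.End.eigenspace (Matrix.toLin' ((matrix S.O q).map (Int.cast : ℤ → ℚ))) 1)
    (Module.End.eigenspace (Matrix.toLin' ((matrix S.O q).map (Int.cast : ℤ → ℚ))) (-1))
  rw [S.eigenspace_one_sup_eigenspace_neg_one_of_dvd hq, S.eigenspace_one_inf_eigenspace_neg_one_of_dvd hq, finrank_top,
    finrank_bot, add_zero, Module.finrank_fintype_fun_eq_card, ← Nat.card_eq_fintype_card] at key
  omega

/-- **`2 dim E₊(T(q)) = #Cls O + tr T(q)`** — the multiplicity of the eigenvalue `+1` of `T(q)` on the Brandt module is the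
number of `W_{q⁻}`-orbits, `½(h + #Fix W_{q⁻})`. [cite: VignerasLNM800, Ch. III §5 exercice 5.8 (c) and Ch. V §2 Prop. 2.4] -/
theorem XiSetup.two_mul_finrank_eigenspace_one_of_dvd (hq : q ∣ Nminus) :
    (2 * Module.finrank ℚ (Module.End.eigenspace (Matrix.toLin' ((matrix S.O q).map (Int.cast : ℤ → ℚ))) 1) : ℚ) =
      Nat.card (ClassSet S.O) + ((matrix S.O q).trace : ℚ) := by
  have h1 := S.trace_matrix_ramified_eq_finrank_sub_of_dvd hq
  have h2 := S.finrank_eigenspace_one_add_finrank_eigenspace_neg_one_of_dvd hq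
  have h2' : (Module.finrank ℚ (Module.End.eigenspace (Matrix.toLin' ((matrix S.O q).map (Int.cast : ℤ → ℚ))) 1) : ℚ) +
      Module.finrank ℚ (Module.End.eigenspace (Matrix.toLin' ((matrix S.O q).map (Int.cast : ℤ → ℚ))) (-1)) =
        Nat.card (ClassSet S.O) := by exact_mod_cast h2
  linarith

/-- **`2 dim E₋(T(q)) = #Cls O − tr T(q)`** — the multiplicity of the eigenvalue `−1` of `T(q)` on the Brandt module.
[cite: VignerasLNM800, Ch. III §5 exercice 5.8 (c) and Ch. V §2 Prop. 2.4] -/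
theorem XiSetup.two_mul_finrank_eigenspace_neg_one_of_dvd (hq : q ∣ Nminus) :
    (2 * Module.finrank ℚ (Module.End.eigenspace (Matrix.toLin' ((matrix S.O q).map (Int.cast : ℤ → ℚ))) (-1)) : ℚ) =
      Nat.card (ClassSet S.O) - ((matrix S.O q).trace : ℚ) := by
  have h1 := S.trace_matrix_ramified_eq_finrank_sub_of_dvd hq
  have h2 := S.finrank_eigenspace_one_add_finrank_eigenspace_neg_one_of_dvd hq
  have h2' : (Module.finrank ℚ (Module.End.eigenspace (Matrix.toLin' ((matrix S.O q).map (Int.cast : ℤ → ℚ))) 1) : ℚ) +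
      Module.finrank ℚ (Module.End.eigenspace (Matrix.toLin' ((matrix S.O q).map (Int.cast : ℤ → ℚ))) (-1)) =
        Nat.card (ClassSet S.O) := by exact_mod_cast h2
  linarith

/-- **`2 dim E₋(T(q)) = #Cls O − #{c : O_L(I_c) contains an element of reduced norm q}`** (the trace of `T(q)` counts the
classes whose left order represents `q`, `BrandtMatrixRamifiedDivisors.lean`). [cite: VignerasLNM800, Ch. V §2 Prop. 2.4] [cite: Voight2021, (30.9.3)] -/
theorem XiSetup.two_mul_finrank_eigenspace_neg_one_eq_card_sub_of_dvd (hq : q ∣ Nminus) :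
    (2 * Module.finrank ℚ (Module.End.eigenspace (Matrix.toLin' ((matrix S.O q).map (Int.cast : ℤ → ℚ))) (-1)) : ℚ) =
      Nat.card (ClassSet S.O) - Nat.card {c : ClassSet S.O // ∃ x ∈ leftOrder c.rep, reducedNorm ℚ S.D x = q} := by
  rw [S.two_mul_finrank_eigenspace_neg_one_of_dvd hq, S.trace_matrix_of_dvd_discr hq]
  push_cast
  ring

/-- **`#Typ O ≤ dim E₊(T(q))`**: the functions of the type are `W_{q⁻}`-invariant and `typeOf` is onto. [cite: Voight2021, Remark 17.4.15 and Cor. 18.5.12] -/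
theorem XiSetup.natCard_typeSet_le_finrank_eigenspace_one_of_dvd (hq : q ∣ Nminus) :
    Nat.card (TypeSet S.O) ≤
      Module.finrank ℚ (Module.End.eigenspace (Matrix.toLin' ((matrix S.O q).map (Int.cast : ℤ → ℚ))) 1) := by
  classical
  haveI : Finite (TypeSet S.O) := S.finite_typeSet
  letI : Fintype (TypeSet S.O) := Fintype.ofFinite _
  set E := Module.End.eigenspace (Matrix.toLin' ((matrix S.O q).map (Int.cast : ℤ → ℚ))) 1 with hE
  -- the injective linear map `g ↦ g ∘ typeOf : ℚ^{Typ O} → E₊`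
  let f : (TypeSet S.O → ℚ) →ₗ[ℚ] E :=
    { toFun := fun g => ⟨g ∘ typeOf S.O, S.comp_typeOf_mem_eigenspace_one_of_dvd hq g⟩
      map_add' := fun g g' => rfl
      map_smul' := fun a g => rfl }
  have hf : Function.Injective f := by
    intro g g' h
    funext τ
    obtain ⟨c, rfl⟩ := typeOf_surjective (O := S.O) τ
    have := congrArg (fun v : E => (v : ClassSet S.O → ℚ) c) h
    exact this
  have h := LinearMap.finrank_le_finrank_of_injective hf
  rwa [Module.finrank_fintype_fun_eq_card, ← Nat.card_eq_fintype_card] at h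

/-- `+1` is an eigenvalue of `T(q)` (the constant functions). [cite: VignerasLNM800, Ch. III §5 exercice 5.8 (c)] -/
theorem XiSetup.hasEigenvalue_one_of_dvd (hq : q ∣ Nminus) :
    Module.End.HasEigenvalue (Matrix.toLin' ((matrix S.O q).map (Int.cast : ℤ → ℚ))) 1 := by
  rw [Module.End.hasEigenvalue_iff, Ne, ← Submodule.finrank_eq_zero]
  have h := S.natCard_typeSet_le_finrank_eigenspace_one_of_dvd hq
  have ht := S.natCard_typeSet_pos
  omega

/-- **`−1` is an eigenvalue of `T(q)` iff some class is moved by `W_{q⁻}`, iff some left order `O_L(I_c)` contains no element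
of reduced norm `q`.** [cite: Voight2021, (30.9.3) and Prop. 30.9.2 (proof)] [cite: VignerasLNM800, Ch. III §5 exercice 5.8 (c)] -/
theorem XiSetup.hasEigenvalue_neg_one_iff_of_dvd (hq : q ∣ Nminus) :
    Module.End.HasEigenvalue (Matrix.toLin' ((matrix S.O q).map (Int.cast : ℤ → ℚ))) (-1) ↔
      ∃ c : ClassSet S.O, ¬ ∃ x ∈ leftOrder c.rep, reducedNorm ℚ S.D x = q := by
  classical
  rw [Module.End.hasEigenvalue_iff, Ne, ← Submodule.finrank_eq_zero]
  have h2 := S.two_mul_finrank_eigenspace_neg_one_eq_card_sub_of_dvd hq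
  have hsub : Nat.card {c : ClassSet S.O // ∃ x ∈ leftOrder c.rep, reducedNorm ℚ S.D x = q} ≤ Nat.card (ClassSet S.O) := by
    rw [Nat.card_eq_fintype_card, Nat.card_eq_fintype_card]
    exact Fintype.card_subtype_le _
  have hiff : Nat.card {c : ClassSet S.O // ∃ x ∈ leftOrder c.rep, reducedNorm ℚ S.D x = q} = Nat.card (ClassSet S.O) ↔
      ∀ c : ClassSet S.O, ∃ x ∈ leftOrder c.rep, reducedNorm ℚ S.D x = q := by
    rw [Nat.card_eq_fintype_card, Nat.card_eq_fintype_card, Fintype.card_subtype, Finset.card_eq_iff_eq_univ,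
      Finset.eq_univ_iff_forall]
    simp only [Finset.mem_filter, Finset.mem_univ, true_and]
  constructor
  · intro hne
    by_contra hall
    push Not at hall
    have hcard := hiff.mpr hall
    apply hne
    have : (2 * Module.finrank ℚ (Module.End.eigenspace (Matrix.toLin' ((matrix S.O q).map (Int.cast : ℤ → ℚ))) (-1)) : ℚ) = 0 := by
      rw [h2, hcard, sub_self]
    exact_mod_cast (mul_eq_zero.mp this).resolve_left two_ne_zero
  · rintro ⟨c, hc⟩ h0
    have hlt : Nat.card {c : ClassSet S.O // ∃ x ∈ leftOrder c.rep, reducedNorm ℚ S.D x = q} < Nat.card (ClassSet S.O) := by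
      refine lt_of_le_of_ne hsub fun heq => hc (hiff.mp heq c)
    have : (2 * Module.finrank ℚ (Module.End.eigenspace (Matrix.toLin' ((matrix S.O q).map (Int.cast : ℤ → ℚ))) (-1)) : ℚ) = 0 := by
      rw [h0]; norm_num
    rw [h2] at this
    have : (Nat.card {c : ClassSet S.O // ∃ x ∈ leftOrder c.rep, reducedNorm ℚ S.D x = q} : ℚ) = Nat.card (ClassSet S.O) := by
      linarith
    exact absurd (by exact_mod_cast this) hlt.ne

end Eigenspaces

end Brandt

end Literature.NumberTheory.Automorphic
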